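import Summits.KontsevichZagierPeriods.KontsevichZagierPeriods.Theorems.TerasomaMultiplicationMultiplicationAccessibleStubDupPhi

/-!
# `MultiplicationAccessible` (stmt-KontsevichZagierPeriods-12305), line
`shifted-family-prime-sieve`, stub `blowupChartThree`

The corner blow-up chart of the open cube `(0,1)³` as ONE change-of-variables move
(Kontsevich–Zagier rule (2), `KZ.changeOfVariablesRel`). In coordinates
`u = (θ₁, θ₂, y) = (u 0, u 1, u 2)` on
`U = {θ₁, θ₂ > 0, θ₁ + θ₂ < 1, y > 0, yθ₀ < 1, yθ₁ < 1, yθ₂ < 1}`, `θ₀ = 1 − θ₁ − θ₂`, the chart is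
`Φ(u) = (1 − yθ₀, 1 − yθ₁, 1 − yθ₂)`; for every integrand `G` making both sides integral
representations, `[U, G(Φ u)·y²] ∼ [(0,1)³, G]`.

* `Φ` is polynomial, hence a `ℚ`-semialgebraic map on any `ℚ`-semialgebraic set
  (`isSemialgebraicMapOn_blowupPhi`);
* its Jacobian matrix w.r.t. `(θ₁, θ₂, y)` has rows `(y, y, −θ₀)`, `(−y, 0, −θ₁)`, `(0, −y, −θ₂)`
  (`hasFDerivAt_blowupPhi`), of determinant `−y²` (`det_blowupPhiDeriv`), so `|det| = y²`;
* `Φ` maps `U` into the cube (`blowupPhi_mapsTo`), injectively (`blowupPhi_injOn`: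
  `y = 3 − ΣΦₖ`, `θ_k = (1 − Φ_k)/y`) and onto (`blowupPhi_surjOn`: the preimage of `t` is
  `((1 − t₁)/y, (1 − t₂)/y, y)`, `y = 3 − t₀ − t₁ − t₂`), so `Φ '' U = (0,1)³` (`blowupPhi_image`).

As in the sibling stub file `…StubDupPhi.lean`, the chart lemmas are stated for an arbitrary `Φ`
under its defining equation `hΦ` and an arbitrary `Φ'` under `hΦ'` (the continuous linear map of
the Jacobian matrix); `blowupChartThree` instantiates them. No definitions, no notation.

References: M. Kontsevich, D. Zagier, *Periods* (2001), §1.2 rule (2).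
-/

noncomputable section

open MeasureTheory Set
open scoped BigOperators
open Literature.NumberTheory.Transcendental
open Literature.NumberTheory.Transcendental.KZ
open Literature.ModelTheory.ExponentialFields (IsSemialgebraic)
open MvPolynomial (aeval X C)

namespace Summit.KontsevichZagierPeriods.TerasomaMultiplication.MultiplicationAccessible

namespace BlowupChart

/-- Membership in the open cube `(0,1)³`, coordinatewise. [folklore] -/
theorem mem_box3 {t : Fin 3 → ℝ} :
    t ∈ {t : Fin 3 → ℝ | ∀ i, t i ∈ Set.Ioo (0:ℝ) 1} ↔
      (0 < t 0 ∧ t 0 < 1) ∧ (0 < t 1 ∧ t 1 < 1) ∧ (0 < t 2 ∧ t 2 < 1) := by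
  refine ⟨fun h => ⟨h 0, h 1, h 2⟩, fun h i => ?_⟩
  fin_cases i
  exacts [h.1, h.2.1, h.2.2]

section Chart

variable {Φ : (Fin 3 → ℝ) → (Fin 3 → ℝ)}
  (hΦ : ∀ u, Φ u = ![1 - u 2 * (1 - u 0 - u 1), 1 - u 2 * u 0, 1 - u 2 * u 1])

include hΦ

/-- The three coordinates of the blow-up chart. [folklore] -/
theorem blowupPhi_apply (u : Fin 3 → ℝ) :
    Φ u 0 = 1 - u 2 * (1 - u 0 - u 1) ∧ Φ u 1 = 1 - u 2 * u 0 ∧ Φ u 2 = 1 - u 2 * u 1 := by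
  rw [hΦ]
  exact ⟨rfl, rfl, rfl⟩

/-- `Φ` maps the chart domain `U` into the open cube. [folklore] -/
theorem blowupPhi_mapsTo :
    MapsTo Φ {u : Fin 3 → ℝ | 0 < u 0 ∧ 0 < u 1 ∧ u 0 + u 1 < 1 ∧ 0 < u 2 ∧
        u 2 * (1 - u 0 - u 1) < 1 ∧ u 2 * u 0 < 1 ∧ u 2 * u 1 < 1}
      {t : Fin 3 → ℝ | ∀ i, t i ∈ Set.Ioo (0:ℝ) 1} := by
  intro u hu
  obtain ⟨h0, h1, h01, h2, hθ0, hθ1, hθ2⟩ := hu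
  rw [mem_box3, (blowupPhi_apply hΦ u).1, (blowupPhi_apply hΦ u).2.1, (blowupPhi_apply hΦ u).2.2]
  have hp0 : 0 < u 2 * (1 - u 0 - u 1) := mul_pos h2 (by linarith)
  have hp1 : 0 < u 2 * u 0 := mul_pos h2 h0
  have hp2 : 0 < u 2 * u 1 := mul_pos h2 h1
  exact ⟨⟨by linarith, by linarith⟩, ⟨by linarith, by linarith⟩, ⟨by linarith, by linarith⟩⟩

/-- `Φ` is injective on the chart domain: `y = 3 − Φ₀ − Φ₁ − Φ₂` and then `θ_k = (1 − Φ_k)/y`.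
[folklore] -/
theorem blowupPhi_injOn :
    InjOn Φ {u : Fin 3 → ℝ | 0 < u 0 ∧ 0 < u 1 ∧ u 0 + u 1 < 1 ∧ 0 < u 2 ∧
        u 2 * (1 - u 0 - u 1) < 1 ∧ u 2 * u 0 < 1 ∧ u 2 * u 1 < 1} := by
  intro u hu u' _ heq
  obtain ⟨-, -, -, h2, -⟩ := hu
  have e0 := congr_fun heq 0
  have e1 := congr_fun heq 1
  have e2 := congr_fun heq 2
  rw [(blowupPhi_apply hΦ u).1, (blowupPhi_apply hΦ u').1] at e0
  rw [(blowupPhi_apply hΦ u).2.1, (blowupPhi_apply hΦ u').2.1] at e1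
  rw [(blowupPhi_apply hΦ u).2.2, (blowupPhi_apply hΦ u').2.2] at e2
  have hy : u 2 = u' 2 := by linear_combination -e0 - e1 - e2
  have hne : u 2 ≠ 0 := h2.ne'
  have h00 : u 0 = u' 0 := by
    refine mul_left_cancel₀ hne ?_
    linear_combination -e1 - (u' 0) * hy
  have h11 : u 1 = u' 1 := by
    refine mul_left_cancel₀ hne ?_
    linear_combination -e2 - (u' 1) * hy
  funext i
  fin_cases i
  exacts [h00, h11, hy]

/-- `Φ` maps the chart domain ONTO the open cube: the preimage of `t` is
`((1 − t₁)/y, (1 − t₂)/y, y)` with `y = 3 − t₀ − t₁ − t₂`. [folklore] -/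
theorem blowupPhi_surjOn :
    SurjOn Φ {u : Fin 3 → ℝ | 0 < u 0 ∧ 0 < u 1 ∧ u 0 + u 1 < 1 ∧ 0 < u 2 ∧
        u 2 * (1 - u 0 - u 1) < 1 ∧ u 2 * u 0 < 1 ∧ u 2 * u 1 < 1}
      {t : Fin 3 → ℝ | ∀ i, t i ∈ Set.Ioo (0:ℝ) 1} := by
  intro t ht
  rw [mem_box3] at ht
  obtain ⟨⟨k0, k0'⟩, ⟨k1, k1'⟩, ⟨k2, k2'⟩⟩ := ht
  have hy : 0 < 3 - t 0 - t 1 - t 2 := by linarith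
  have hy' : (3 - t 0 - t 1 - t 2) ≠ 0 := hy.ne'
  have c1 : (3 - t 0 - t 1 - t 2) * ((1 - t 1) / (3 - t 0 - t 1 - t 2)) = 1 - t 1 := by
    field_simp
  have c2 : (3 - t 0 - t 1 - t 2) * ((1 - t 2) / (3 - t 0 - t 1 - t 2)) = 1 - t 2 := by
    field_simp
  have c0 : (3 - t 0 - t 1 - t 2) *
      (1 - (1 - t 1) / (3 - t 0 - t 1 - t 2) - (1 - t 2) / (3 - t 0 - t 1 - t 2)) = 1 - t 0 := by
    field_simp
    ring
  have c01 : (1 - t 1) / (3 - t 0 - t 1 - t 2) + (1 - t 2) / (3 - t 0 - t 1 - t 2) =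
      (2 - t 1 - t 2) / (3 - t 0 - t 1 - t 2) := by
    field_simp
    ring
  refine ⟨![(1 - t 1) / (3 - t 0 - t 1 - t 2), (1 - t 2) / (3 - t 0 - t 1 - t 2),
    3 - t 0 - t 1 - t 2], ?_, ?_⟩
  · simp only [mem_setOf_eq, Matrix.cons_val_zero, Matrix.cons_val_one, Matrix.cons_val_two,
      Matrix.head_cons, Matrix.tail_cons]
    refine ⟨div_pos (by linarith) hy, div_pos (by linarith) hy, ?_, hy, ?_, ?_, ?_⟩
    · rw [c01, div_lt_one hy]
      linarith
    · rw [c0]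
      linarith
    · rw [c1]
      linarith
    · rw [c2]
      linarith
  · rw [hΦ]
    funext i
    fin_cases i
    · simp only [Matrix.cons_val_zero, Matrix.cons_val_one, Matrix.cons_val_two, Matrix.head_cons,
        Matrix.tail_cons, Fin.zero_eta]
      rw [c0]
      ring
    · simp only [Matrix.cons_val_zero, Matrix.cons_val_one, Matrix.cons_val_two, Matrix.head_cons,
        Matrix.tail_cons, Fin.mk_one]
      rw [c1]
      ring
    · simp only [Fin.reduceFinMk, Matrix.cons_val, Matrix.cons_val_one, Matrix.cons_val_two,
        Matrix.head_cons, Matrix.tail_cons]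
      rw [c2]
      ring

/-- The image of the chart domain under `Φ` is the open cube (the `r'.domain = Φ '' r.domain`
side condition of the move). [folklore] -/
theorem blowupPhi_image :
    Φ '' {u : Fin 3 → ℝ | 0 < u 0 ∧ 0 < u 1 ∧ u 0 + u 1 < 1 ∧ 0 < u 2 ∧
        u 2 * (1 - u 0 - u 1) < 1 ∧ u 2 * u 0 < 1 ∧ u 2 * u 1 < 1} =
      {t : Fin 3 → ℝ | ∀ i, t i ∈ Set.Ioo (0:ℝ) 1} :=
  (blowupPhi_surjOn hΦ).image_eq_of_mapsTo (blowupPhi_mapsTo hΦ)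

/-- `Φ` is a `ℚ`-semialgebraic map on every `ℚ`-semialgebraic set: its coordinates are the
polynomials `1 − X₂(1 − X₀ − X₁)`, `1 − X₂X₀`, `1 − X₂X₁`. [cite: KontsevichZagier2001, §1.2] -/
theorem isSemialgebraicMapOn_blowupPhi {σ : Set (Fin 3 → ℝ)} (hσ : IsSemialgebraic ℚ σ) :
    IsSemialgebraicMapOn ℚ σ Φ := by
  refine (isSemialgebraicMapOn_aeval hσ
    ![(1 - X 2 * (1 - X 0 - X 1) : MvPolynomial (Fin 3) ℚ), 1 - X 2 * X 0, 1 - X 2 * X 1]).congr ?_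
  intro u _
  rw [hΦ u]
  funext j
  fin_cases j <;> simp

variable {Φ' : (Fin 3 → ℝ) → (Fin 3 → ℝ) →L[ℝ] (Fin 3 → ℝ)}
  (hΦ' : ∀ u, Φ' u = (Matrix.toLin' !![u 2, u 2, -(1 - u 0 - u 1); -(u 2), 0, -(u 0);
    0, -(u 2), -(u 1)]).toContinuousLinearMap)

include hΦ'

omit hΦ in
/-- `det Φ'(u) = −y²`: `Φ' u` is the linear map of the Jacobian matrix with rows
`(y, y, −θ₀)`, `(−y, 0, −θ₁)`, `(0, −y, −θ₂)`. [folklore] -/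
theorem det_blowupPhiDeriv (u : Fin 3 → ℝ) : (Φ' u).det = -(u 2 ^ 2) := by
  rw [hΦ', LinearMap.det_toContinuousLinearMap, LinearMap.det_toLin', Matrix.det_fin_three]
  simp
  ring

/-- `Φ` has derivative `Φ' u` at every point: row by row (`hasFDerivAt_pi''`), product rule for
the polynomial coordinates. [folklore] -/
theorem hasFDerivAt_blowupPhi (u : Fin 3 → ℝ) : HasFDerivAt Φ (Φ' u) u := by
  rw [show Φ = fun u => ![1 - u 2 * (1 - u 0 - u 1), 1 - u 2 * u 0, 1 - u 2 * u 1] from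
    funext hΦ, hΦ']
  have h0 := hasFDerivAt_apply (𝕜 := ℝ) (0 : Fin 3) u
  have h1 := hasFDerivAt_apply (𝕜 := ℝ) (1 : Fin 3) u
  have h2 := hasFDerivAt_apply (𝕜 := ℝ) (2 : Fin 3) u
  refine hasFDerivAt_pi'' fun i => ?_
  fin_cases i
  · change HasFDerivAt (fun w : Fin 3 → ℝ => 1 - w 2 * (1 - w 0 - w 1)) _ u
    refine ((h2.mul ((h0.const_sub 1).sub h1)).const_sub 1).congr_fderiv
      (ContinuousLinearMap.ext fun v => ?_)
    simp [Matrix.toLin'_apply, dotProduct, Fin.sum_univ_three]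
    ring
  · change HasFDerivAt (fun w : Fin 3 → ℝ => 1 - w 2 * w 0) _ u
    refine ((h2.mul h0).const_sub 1).congr_fderiv (ContinuousLinearMap.ext fun v => ?_)
    simp [Matrix.toLin'_apply, dotProduct, Fin.sum_univ_three]
    ring
  · change HasFDerivAt (fun w : Fin 3 → ℝ => 1 - w 2 * w 1) _ u
    refine ((h2.mul h1).const_sub 1).congr_fderiv (ContinuousLinearMap.ext fun v => ?_)
    simp [Matrix.toLin'_apply, dotProduct, Fin.sum_univ_three]
    ring

end Chart

end BlowupChart

/-- **Registered stub `blowupChartThree`** (line `shifted-family-prime-sieve` of crux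
stmt-KontsevichZagierPeriods-12305). The corner blow-up chart of the open cube `(0,1)³`,
`Φ(θ₁, θ₂, y) = (1 − yθ₀, 1 − yθ₁, 1 − yθ₂)`, `θ₀ = 1 − θ₁ − θ₂`, on
`U = {θ₁, θ₂ > 0, θ₁ + θ₂ < 1, y > 0, yθ_k < 1}`, is ONE change-of-variables move
(`KZ.changeOfVariablesRel`, `|det DΦ| = y²`, `Φ '' U = (0,1)³`): `[U, G(Φ u)·y²] ∼ [(0,1)³, G]`.
[cite: KontsevichZagier2001, §1.2] -/
theorem blowupChartThree : ∀ (x s : ℚ), 0 < x → 0 < s → ∀ (G : (Fin 3 → ℝ) → ℝ), (∀ t : Fin 3 → ℝ, G t = (1 + t 0 / (t 0 * t 1 * t 2) ^ ((1:ℝ)/3) + t 0 * t 1 / ((t 0 * t 1 * t 2) ^ ((1:ℝ)/3)) ^ 2) / 3 * ∏ k : Fin 3, (t k) ^ ((x:ℝ) + ((k:ℕ):ℝ) / 3 - 1) * (1 - t k) ^ ((s:ℝ) - 1)) → ∀ (r r₀ : KZ.IntegralRep 3), r.domain = {u | 0 < u 0 ∧ 0 < u 1 ∧ u 0 + u 1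 < 1 ∧ 0 < u 2 ∧ u 2 * (1 - u 0 - u 1) < 1 ∧ u 2 * u 0 < 1 ∧ u 2 * u 1 < 1} → Set.EqOn r.integrand (fun u => G ![1 - u 2 * (1 - u 0 - u 1), 1 - u 2 * u 0, 1 - u 2 * u 1] * u 2 ^ 2) r.domain → r₀.domain = {t | ∀ i, t i ∈ Set.Ioo (0:ℝ) 1} → Set.EqOn r₀.integrand G r₀.domain → KZ.Equivalent r r₀ := by
  intro x s _ _ G _ r r₀ hr hri hr₀ hr₀i
  -- the explicit chart and the continuous linear map of its Jacobian matrix, kept opaque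
  obtain ⟨Φ, hΦ⟩ : ∃ Φ : (Fin 3 → ℝ) → (Fin 3 → ℝ),
      ∀ u, Φ u = ![1 - u 2 * (1 - u 0 - u 1), 1 - u 2 * u 0, 1 - u 2 * u 1] :=
    ⟨_, fun _ => rfl⟩
  obtain ⟨Φ', hΦ'⟩ : ∃ Φ' : (Fin 3 → ℝ) → (Fin 3 → ℝ) →L[ℝ] (Fin 3 → ℝ),
      ∀ u, Φ' u = (Matrix.toLin' !![u 2, u 2, -(1 - u 0 - u 1); -(u 2), 0, -(u 0);
        0, -(u 2), -(u 1)]).toContinuousLinearMap :=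
    ⟨_, fun _ => rfl⟩
  -- the side conditions of the move on `r.domain = U`
  have hsa : IsSemialgebraicMapOn ℚ r.domain Φ :=
    BlowupChart.isSemialgebraicMapOn_blowupPhi hΦ r.isSemialgebraic_domain
  have hinj : InjOn Φ r.domain := hr ▸ BlowupChart.blowupPhi_injOn hΦ
  have himage : r₀.domain = Φ '' r.domain := by
    rw [hr, BlowupChart.blowupPhi_image hΦ, hr₀]
  refine changeOfVariablesRel_subset_relations ⟨3, r, r₀, Φ, Φ', hsa,
    fun u _ => (BlowupChart.hasFDerivAt_blowupPhi hΦ hΦ' u).hasFDerivWithinAt, hinj, himage,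
    fun u hu => ?_, rfl⟩
  -- the pull-back identity on `r.domain`, Jacobian `|−y²| = y²` included
  have hΦu : Φ u ∈ r₀.domain := himage ▸ mem_image_of_mem Φ hu
  rw [hri hu, hr₀i hΦu, BlowupChart.det_blowupPhiDeriv hΦ' u, abs_neg, abs_of_nonneg (sq_nonneg _),
    hΦ u]

end Summit.KontsevichZagierPeriods.TerasomaMultiplication.MultiplicationAccessible
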